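import Summits.RiemannHypothesis.RiemannHypothesis.Theorems.JensenPolynomialsXiDeltaLowerBL
import Literature.NumberTheory.LFunctions.XiLadderTailInputs
import Summits.RiemannHypothesis.RiemannHypothesis.Theses.JensenPolynomials

/-!
# Route `JensenPolynomials`, support item `XiDeltaLower052` (effective S-T5) PROVED: `δ(M) = 2MΔ(M)² ≥ 13/25` for every
`M ≥ 10⁴`, zero-free, by ONE Brascamp–Lieb cell (RH-FREE proof-of-data; cell rh-jensen, HUMAN RULING D-0040)

DESIGN (engine seat rh-jensen-eng-5, ET3.md §5; exact identity checked by rh-jensen-theory g7 `two_mul_deltaSq_mul`): with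
`ν = ν_{2M} ∝ u^{2M}Φ(u)du`, `U = u⁻²`, `ρ_M := M_{2M−4}M_{2M}/M_{2M−2}² = E_ν[U²]/E_ν[U]²` and the moment dictionary
`γ(M−2)γ(M)/γ(M−1)² = ((2M−3)/(2M−1))·ρ_M` (`xiTaylorCoeff_window_ratio`; `γ(n) = 64·4ⁿn!/(2n)!·M_{2n}`), one has
`δ(M) = M(1 − γ(M−2)γ(M)/γ(M−1)²)`. Part 1 (`xiMoment_mul_le_sq_of_bl`) bounds `ρ_M(1 − c) ≤ 1`; this file supplies THE CELL:
a critical point `a ≥ 1.69` of `W_{2M−4}` (`exists_xi_mode_ge`; `e^{6.76} < 870`), the cut `u₀ = a − 1/10` with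
`4(2M) ≤ 16πu₀²e^{4u₀}` (`four_mul_le_curvature_at_cut`: upper envelope `−Φ′/Φ ≤ 4πe^{4u} − 9` at the mode, `e^{−2/5} ≥ 0.6703`,
`(a − 1/10)² ≥ 1.4959a`) and the left mass `ν_{2M−4}(u < u₀) ≤ 1/40` (`leftMass_cut_le` from `xi_leftMass_le`, window `1/40`:
the exponent is `≤ 0` and `200/R ≤ 1/40` since `e^{4a} ≥ 287`), whence `c ≤ 9/(20M)`, `ρ_M ≤ 20M/(20M − 9)` and
`δ(M) ≥ (M(22M + 9))/((2M−1)(20M−9))·… ≥ 13/25` (`two_mul_gorttwDeltaSq_ge`; the final polynomial inequality is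
`30k² + 839k + 1441 ≥ 0`). MEASURED (eng-5, two γ-lineages): `δ(10⁴) = 0.7449…`, increasing; this proof certifies `≥ 0.52`
with the floor `ρ_M − 1 ≤ 9/(20M − 9)` (truth `≈ 0.255/M` at `10⁴`).

ITEM CLOSER: `xiDeltaLower052_item : Theses.JensenPolynomials.XiDeltaLower052`. Axioms standard; import closure zero-free
and height-free. WHAT THIS IS NOT: a statement about ratios of three consecutive Taylor coefficients of `ξ`; nothing here
bears on the zeros of `ζ`. References: Brascamp–Lieb 1976 Thm 4.1 [BrascampLieb1976]; Csordas–Norfolk–Varga 1986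
[CsordasNorfolkVarga1986]; GORZ 2019 Thm 7 [GORZPNAS2019]; Griffin et al. 2022 (GORTTW) (2.2) [GriffinEtAl2022].
-/

noncomputable section
-- D-0017: `Summit.RiemannHypothesis.RiemannHypothesis.…` duplicates the namespace BY DESIGN (single-problem summit).
set_option linter.dupNamespace false

namespace Summit.RiemannHypothesis.RiemannHypothesis.Theorems.JensenPolynomials

open Literature.NumberTheory.LFunctions Literature.Probability.Distributions MeasureTheory Set Filter
open scoped Topology ENNReal Nat

/-! ## 3. Numerical constants -/

/-- `e^{2/5} ≤ 1.49186`, hence `e^{−2/5} ≥ 0.6703`. -/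
theorem exp_two_fifths_le : Real.exp (2 / 5) ≤ 1.49186 := by
  have h := Real.exp_bound' (x := (2 / 5 : ℝ)) (by norm_num) (by norm_num) (n := 8) (by norm_num)
  have e : (∑ m ∈ Finset.range 8, (2 / 5 : ℝ) ^ m / m.factorial) + (2 / 5 : ℝ) ^ 8 * (8 + 1) / (Nat.factorial 8 * 8) ≤
      1.49186 := by
    simp only [Finset.sum_range_succ, Finset.sum_range_zero, Nat.factorial]
    norm_num
  exact h.trans e

/-- `e^{−2/5} ≥ 0.6703`. -/
theorem exp_neg_two_fifths_ge : (0.6703 : ℝ) ≤ Real.exp (-(2 / 5)) := by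
  rw [Real.exp_neg, le_inv_comm₀ (by norm_num) (Real.exp_pos _)]
  exact exp_two_fifths_le.trans (by norm_num)

/-- `e^{1/10} ≤ 1.11`. -/
theorem exp_tenth_le : Real.exp (1 / 10) ≤ 1.11 := by
  have h := Real.exp_bound' (x := (1 / 10 : ℝ)) (by norm_num) (by norm_num) (n := 2) (by norm_num)
  have e : (∑ m ∈ Finset.range 2, (1 / 10 : ℝ) ^ m / m.factorial) + (1 / 10 : ℝ) ^ 2 * (2 + 1) / (Nat.factorial 2 * 2) ≤
      1.11 := by
    simp only [Finset.sum_range_succ, Finset.sum_range_zero, Nat.factorial]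
    norm_num
  exact h.trans e

/-- `e^{6.76} < 870` (for the mode bracket at `α₀ = 1.69`). -/
theorem exp_676_lt : Real.exp (4 * (169 / 100)) < 870 := by
  have h1 : Real.exp 6 < 403.43 := by
    have h := Real.exp_one_lt_d9
    have e : Real.exp 6 = Real.exp 1 ^ 6 := by rw [← Real.exp_nat_mul]; norm_num
    rw [e]
    calc Real.exp 1 ^ 6 < 2.7182818286 ^ 6 := pow_lt_pow_left₀ h (Real.exp_pos 1).le (by norm_num)
      _ < 403.43 := by norm_num
  have h2 : Real.exp (76 / 100) ≤ 2.1383 := by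
    have h := Real.exp_bound' (x := (76 / 100 : ℝ)) (by norm_num) (by norm_num) (n := 6) (by norm_num)
    have e : (∑ m ∈ Finset.range 6, (76 / 100 : ℝ) ^ m / m.factorial) +
        (76 / 100 : ℝ) ^ 6 * (6 + 1) / (Nat.factorial 6 * 6) ≤ 2.1383 := by
      simp only [Finset.sum_range_succ, Finset.sum_range_zero, Nat.factorial]
      norm_num
    exact h.trans e
  have e : Real.exp (4 * (169 / 100)) = Real.exp 6 * Real.exp (76 / 100) := by
    rw [← Real.exp_add]; norm_num
  rw [e]
  calc Real.exp 6 * Real.exp (76 / 100) ≤ 403.43 * 2.1383 :=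
        mul_le_mul h1.le h2 (Real.exp_pos _).le (by norm_num)
    _ < 870 := by norm_num

/-- `e^{4a} ≥ 287` for `a ≥ 1.69`. -/
theorem exp_four_mul_ge {a : ℝ} (ha : 169 / 100 ≤ a) : (287 : ℝ) ≤ Real.exp (4 * a) := by
  have h1 : (4.118 : ℝ) ≤ Real.exp (169 / 100) :=
    le_trans (by norm_num) (Real.quadratic_le_exp_of_nonneg (show (0 : ℝ) ≤ 169 / 100 by norm_num))
  have h2 : Real.exp (169 / 100) ≤ Real.exp a := Real.exp_le_exp.2 ha
  have e : Real.exp (4 * a) = Real.exp a ^ 4 := by rw [← Real.exp_nat_mul]; norm_num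
  rw [e]
  calc (287 : ℝ) ≤ 4.118 ^ 4 := by norm_num
    _ ≤ Real.exp a ^ 4 := pow_le_pow_left₀ (by norm_num) (h1.trans h2) 4

/-! ## 4. The one-cell estimate: the cut `u₀ = a − 1/10` below the mode `a ≥ 1.69` of `W_m` -/

/-- **κ₀ ≥ 4**: at a critical point `a ≥ 1.69` of `W_m` with `m ≥ 1482`, the cut `u₀ = a − 1/10` satisfies
`4(m+4) ≤ 16πu₀²e^{4u₀}` (upper envelope `−Φ′/Φ ≤ 4πe^{4u} − 9` at the mode). -/
theorem four_mul_le_curvature_at_cut (m : ℕ) (hm : (1482 : ℝ) ≤ m) {a : ℝ} (ha : 169 / 100 ≤ a)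
    (hmode : (m : ℝ) / a + deBruijnPhiDeriv a / deBruijnPhi a = 0) :
    4 * ((m : ℝ) + 4) ≤ 16 * Real.pi * ((a - 1 / 10) ^ 2 * Real.exp (4 * (a - 1 / 10))) := by
  have ha0 : 0 < a := by linarith
  have henv := neg_deBruijnPhiDeriv_div_le ha0.le
  have hL : (m : ℝ) / a = -deBruijnPhiDeriv a / deBruijnPhi a := by
    have : -deBruijnPhiDeriv a / deBruijnPhi a = -(deBruijnPhiDeriv a / deBruijnPhi a) := by ring
    rw [this]; linarith
  -- `4πe^{4a} ≥ m/a`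
  have h4pi : (m : ℝ) / a ≤ 4 * Real.pi * Real.exp (4 * a) := by rw [hL]; linarith
  have hm_le : (m : ℝ) ≤ a * (4 * Real.pi * Real.exp (4 * a)) := by
    rw [div_le_iff₀ ha0] at h4pi; linarith
  -- `e^{4(a − 1/10)} = e^{4a}e^{−2/5} ≥ 0.6703 e^{4a}`
  have hexp : Real.exp (4 * (a - 1 / 10)) = Real.exp (4 * a) * Real.exp (-(2 / 5)) := by
    rw [← Real.exp_add]; congr 1; ring
  have hE : 0.6703 * Real.exp (4 * a) ≤ Real.exp (4 * (a - 1 / 10)) := by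
    rw [hexp, mul_comm]
    exact mul_le_mul_of_nonneg_left exp_neg_two_fifths_ge (Real.exp_pos _).le
  -- `(a − 1/10)² ≥ 1.4959 a`
  have hsq : 1.4959 * a ≤ (a - 1 / 10) ^ 2 := by nlinarith
  have hπ := Real.pi_gt_three
  have hE0 : 0 < Real.exp (4 * a) := Real.exp_pos _
  -- chain: 16π(a−1/10)²e^{4(a−1/10)} ≥ 16π·1.4959a·0.6703e^{4a} = 4·(1.4959·0.6703)·a·4πe^{4a} ≥ 4·1.0027·m
  have h1 : 16 * Real.pi * (1.4959 * a * (0.6703 * Real.exp (4 * a))) ≤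
      16 * Real.pi * ((a - 1 / 10) ^ 2 * Real.exp (4 * (a - 1 / 10))) := by
    apply mul_le_mul_of_nonneg_left _ (by positivity)
    exact mul_le_mul hsq hE (by positivity) (by positivity)
  have h2 : 16 * Real.pi * (1.4959 * a * (0.6703 * Real.exp (4 * a))) =
      4 * (1.4959 * 0.6703) * (a * (4 * Real.pi * Real.exp (4 * a))) := by ring
  rw [h2] at h1
  nlinarith

/-- **P′ ≤ 1/40**: the mass of `ν_m` below the cut `a − 1/10` (`a ≥ 1.69` a critical point of `W_m`) is at most
`1/40` (`xi_leftMass_le` with window `1/40`; the exponent is `≤ 0` and the prefactor `200/R ≤ 1/40`). -/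
theorem leftMass_cut_le (m : ℕ) {a : ℝ} (ha : 169 / 100 ≤ a)
    (hmode : (m : ℝ) / a + deBruijnPhiDeriv a / deBruijnPhi a = 0) :
    (∫ u in Ioo 0 (a - 1 / 10), deBruijnPhi u * u ^ m) / xiMoment m ≤ 1 / 40 := by
  have ha0 : 0 < a := by linarith
  have hP := xi_leftMass_le m (s := 1 / 40) (τ := 1 / 10) (by norm_num) (by norm_num) (by linarith) (by linarith) hmode
  refine hP.trans ?_
  set R : ℝ := 16 * Real.pi * Real.exp (4 * (a - 1 / 10)) with hR
  set Λ : ℝ := (m : ℝ) / (a - 1 / 40) ^ 2 + 16 * Real.pi * Real.exp (4 * (a + 1 / 40)) * (1 + 1 / 10 ^ 6) with hΛ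
  have hπ := Real.pi_gt_three
  have hE0 : 0 < Real.exp (4 * a) := Real.exp_pos _
  -- `R ≥ 16π·0.6703·e^{4a}`
  have hexp : Real.exp (4 * (a - 1 / 10)) = Real.exp (4 * a) * Real.exp (-(2 / 5)) := by
    rw [← Real.exp_add]; congr 1; ring
  have hRge : 16 * Real.pi * (0.6703 * Real.exp (4 * a)) ≤ R := by
    rw [hR, hexp, mul_comm (Real.exp (4 * a))]
    exact mul_le_mul_of_nonneg_left (mul_le_mul_of_nonneg_right exp_neg_two_fifths_ge hE0.le) (by positivity)
  have hR0 : 0 < R := by rw [hR]; positivity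
  -- `m ≤ 4πa e^{4a}` (mode + upper envelope)
  have henv := neg_deBruijnPhiDeriv_div_le ha0.le
  have hL : (m : ℝ) / a = -deBruijnPhiDeriv a / deBruijnPhi a := by
    have : -deBruijnPhiDeriv a / deBruijnPhi a = -(deBruijnPhiDeriv a / deBruijnPhi a) := by ring
    rw [this]; linarith
  have hm_le : (m : ℝ) ≤ a * (4 * Real.pi * Real.exp (4 * a)) := by
    have h4pi : (m : ℝ) / a ≤ 4 * Real.pi * Real.exp (4 * a) := by rw [hL]; linarith
    rw [div_le_iff₀ ha0] at h4pi; linarith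
  -- `Λ ≤ 87·e^{4a} ≤ 16 R`
  have hsq : 4 * a ≤ 2.44 * (a - 1 / 40) ^ 2 := by nlinarith
  have hsq0 : 0 < (a - 1 / 40) ^ 2 := pow_pos (by linarith) 2
  have hΛ1 : (m : ℝ) / (a - 1 / 40) ^ 2 ≤ 2.44 * (Real.pi * Real.exp (4 * a)) := by
    rw [div_le_iff₀ hsq0]
    nlinarith
  have hexp2 : Real.exp (4 * (a + 1 / 40)) = Real.exp (4 * a) * Real.exp (1 / 10) := by
    rw [← Real.exp_add]; congr 1; ring
  have hΛ2 : 16 * Real.pi * Real.exp (4 * (a + 1 / 40)) * (1 + 1 / 10 ^ 6) ≤ 18 * (Real.pi * Real.exp (4 * a)) := by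
    rw [hexp2]
    have h1 : Real.exp (4 * a) * Real.exp (1 / 10) ≤ Real.exp (4 * a) * 1.11 := mul_le_mul_of_nonneg_left exp_tenth_le hE0.le
    nlinarith [mul_pos Real.pi_pos hE0]
  have hΛle : Λ ≤ 16 * R := by
    rw [hΛ]; nlinarith [mul_pos Real.pi_pos hE0]
  -- the exponential factor is `≤ 1`
  have hfac : Real.exp (-(R * (1 / 10) ^ 2 / 2)) * Real.exp (Λ * (1 / 40) ^ 2 / 2) ≤ 1 := by
    rw [← Real.exp_add, Real.exp_le_one_iff]
    nlinarith
  -- the prefactor: `1/(2·(1/40)·R·(1/10)) = 200/R ≤ 200/(16π·0.6703·287)`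
  have hden : 2 * (1 / 40 : ℝ) * R * (1 / 10) = R / 200 := by ring
  rw [hden]
  have hRbig : (8000 : ℝ) ≤ R := by
    have h287 := exp_four_mul_ge ha
    nlinarith
  calc Real.exp (-(R * (1 / 10) ^ 2 / 2)) * Real.exp (Λ * (1 / 40) ^ 2 / 2) / (R / 200)
      ≤ 1 / (R / 200) := div_le_div_of_nonneg_right hfac (by positivity)
    _ = 200 / R := by field_simp
    _ ≤ 1 / 40 := by rw [div_le_div_iff₀ hR0 (by norm_num)]; linarith

/-! ## 5. Assembly: the Taylor-coefficient ratio, and `δ(M) ≥ 13/25` -/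

/-- The moment dictionary for the window ratio: `γ(k)γ(k+2)/γ(k+1)² = ((2k+1)/(2k+3))·M_{2k}M_{2k+4}/M_{2k+2}²`. -/
theorem xiTaylorCoeff_window_ratio (k : ℕ) :
    xiTaylorCoeff k * xiTaylorCoeff (k + 2) / xiTaylorCoeff (k + 1) ^ 2 =
      (2 * (k : ℝ) + 1) / (2 * (k : ℝ) + 3) * (xiMoment (2 * k) * xiMoment (2 * k + 4) / xiMoment (2 * k + 2) ^ 2) := by
  have hk0 : (0 : ℝ) < k ! := by positivity
  have h2k : (0 : ℝ) < (2 * k)! := by positivity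
  have f1 : (((k + 1)! : ℕ) : ℝ) = ((k : ℝ) + 1) * (k ! : ℝ) := by
    rw [Nat.factorial_succ]; push_cast; ring
  have f2 : (((k + 2)! : ℕ) : ℝ) = ((k : ℝ) + 2) * ((k : ℝ) + 1) * (k ! : ℝ) := by
    rw [show k + 2 = (k + 1) + 1 from rfl, Nat.factorial_succ, Nat.factorial_succ]; push_cast; ring
  have f3 : (((2 * (k + 1))! : ℕ) : ℝ) = (2 * (k : ℝ) + 2) * (2 * (k : ℝ) + 1) * ((2 * k)! : ℝ) := by
    rw [show 2 * (k + 1) = (2 * k + 1) + 1 by ring, Nat.factorial_succ, Nat.factorial_succ]; push_cast; ring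
  have f4 : (((2 * (k + 2))! : ℕ) : ℝ) =
      (2 * (k : ℝ) + 4) * (2 * (k : ℝ) + 3) * (2 * (k : ℝ) + 2) * (2 * (k : ℝ) + 1) * ((2 * k)! : ℝ) := by
    rw [show 2 * (k + 2) = (2 * k + 3) + 1 by ring, Nat.factorial_succ, Nat.factorial_succ,
      show 2 * k + 2 = (2 * k + 1) + 1 by ring, Nat.factorial_succ, Nat.factorial_succ]; push_cast; ring
  set K : ℝ := (32 * 4 ^ (k + 1) * (k ! : ℝ) / ((2 * k)! : ℝ)) ^ 2 / ((2 * (k : ℝ) + 1) ^ 2 * (2 * (k : ℝ) + 3))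
    with hK
  have hKpos : 0 < K := by positivity
  have e1 : xiTaylorCoeff k * xiTaylorCoeff (k + 2) =
      K * ((2 * (k : ℝ) + 1) * xiMoment (2 * k) * xiMoment (2 * k + 4)) := by
    rw [xiTaylorCoeff_eq_xiMoment k, xiTaylorCoeff_eq_xiMoment (k + 2), f2, f4,
      show 2 * (k + 2) = 2 * k + 4 by ring, hK]
    field_simp
    ring
  have e2 : xiTaylorCoeff (k + 1) ^ 2 = K * ((2 * (k : ℝ) + 3) * xiMoment (2 * k + 2) ^ 2) := by
    rw [xiTaylorCoeff_eq_xiMoment (k + 1), f1, f3, show 2 * (k + 1) = 2 * k + 2 by ring, hK]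
    field_simp
    ring
  have hB := xiMoment_pos (2 * k + 2)
  rw [e1, e2]
  field_simp

/-- **Effective Turán defect**: `M_{2k}M_{2k+4}·(1 − 9/(20(k+2))) ≤ M_{2k+2}²` for every `k ≥ 9998` (one Brascamp–Lieb
cell: mode `≥ 1.69`, cut `1/10` below it, `κ₀ ≥ 4`, left mass `≤ 1/40`). -/
theorem xiMoment_turan_defect (k : ℕ) (hk : (9998 : ℝ) ≤ k) :
    xiMoment (2 * k) * xiMoment (2 * k + 4) * (1 - 9 / (20 * ((k : ℝ) + 2))) ≤ xiMoment (2 * k + 2) ^ 2 := by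
  have hπ := Real.pi_lt_d2
  have hexp := exp_676_lt
  have hmR : ((2 * k : ℕ) : ℝ) = 2 * (k : ℝ) := by push_cast; ring
  -- the two modes
  have hcond : 4 * Real.pi * Real.exp (4 * (169 / 100)) - 9 < ((2 * k : ℕ) : ℝ) / (169 / 100) := by
    rw [hmR, lt_div_iff₀ (by norm_num)]; nlinarith [Real.pi_pos]
  have hcond' : 4 * Real.pi * Real.exp (4 * (169 / 100)) - 9 < ((2 * k + 4 : ℕ) : ℝ) / (169 / 100) := by
    push_cast; rw [lt_div_iff₀ (by norm_num)]; nlinarith [Real.pi_pos]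
  obtain ⟨a, ha, hmode⟩ := exists_xi_mode_ge (2 * k) (α₀ := 169 / 100) (by norm_num) hcond
  obtain ⟨a', ha', hmode'⟩ := exists_xi_mode_ge (2 * k + 4) (α₀ := 169 / 100) (by norm_num) hcond'
  -- the cell estimates
  have hD := four_mul_le_curvature_at_cut (2 * k) (by rw [hmR]; linarith) ha hmode
  have hP := leftMass_cut_le (2 * k) ha hmode
  have hBL := xiMoment_mul_le_sq_of_bl (2 * k) (a := a') (u₀ := a - 1 / 10) (D := 4 * (((2 * k : ℕ) : ℝ) + 4))
    (by linarith) (by linarith) (by positivity) hD hmode'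
  -- `1 − c ≥ 1 − 9/(20(k+2))`
  have hA := xiMoment_pos (2 * k)
  have hC := xiMoment_pos (2 * k + 4)
  have hP0 : 0 ≤ (∫ u in Ioo 0 (a - 1 / 10), deBruijnPhi u * u ^ (2 * k)) / xiMoment (2 * k) :=
    div_nonneg (setIntegral_nonneg measurableSet_Ioo fun u hu =>
      (mul_pos (deBruijnPhi_pos_holds u) (pow_pos hu.1 _)).le) hA.le
  rw [hmR] at hBL
  have hc : 1 - 9 / (20 * ((k : ℝ) + 2)) ≤ 1 - 4 / ((2 * (k : ℝ) + 4) + 4 * (2 * (k : ℝ) + 4)) -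
      4 / (2 * (k : ℝ) + 4) * ((∫ u in Ioo 0 (a - 1 / 10), deBruijnPhi u * u ^ (2 * k)) / xiMoment (2 * k)) := by
    have h1 : 4 / (2 * (k : ℝ) + 4) * ((∫ u in Ioo 0 (a - 1 / 10), deBruijnPhi u * u ^ (2 * k)) / xiMoment (2 * k)) ≤
        4 / (2 * (k : ℝ) + 4) * (1 / 40) := mul_le_mul_of_nonneg_left hP (by positivity)
    have h2 : 4 / ((2 * (k : ℝ) + 4) + 4 * (2 * (k : ℝ) + 4)) + 4 / (2 * (k : ℝ) + 4) * (1 / 40) = 9 / (20 * ((k : ℝ) + 2)) := by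
      field_simp; ring
    linarith
  calc xiMoment (2 * k) * xiMoment (2 * k + 4) * (1 - 9 / (20 * ((k : ℝ) + 2)))
      ≤ xiMoment (2 * k) * xiMoment (2 * k + 4) * (1 - 4 / ((2 * (k : ℝ) + 4) + 4 * (2 * (k : ℝ) + 4)) -
          4 / (2 * (k : ℝ) + 4) * ((∫ u in Ioo 0 (a - 1 / 10), deBruijnPhi u * u ^ (2 * k)) / xiMoment (2 * k))) :=
        mul_le_mul_of_nonneg_left hc (mul_pos hA hC).le
    _ ≤ xiMoment (2 * k + 2) ^ 2 := hBL

/-- **`δ(M) = 2MΔ(M)² ≥ 13/25` for every `M ≥ 10⁴`** (the route's support item `XiDeltaLower052`, zero-free). -/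
theorem two_mul_gorttwDeltaSq_ge (M : ℕ) (hM : 10000 ≤ M) :
    (13 / 25 : ℝ) ≤ 2 * (M : ℝ) * gorttwDeltaSq xiTaylorCoeff M := by
  obtain ⟨k, rfl⟩ : ∃ k, M = k + 2 := ⟨M - 2, by omega⟩
  have hk : (9998 : ℝ) ≤ k := by
    have : (10000 : ℝ) ≤ ((k + 2 : ℕ) : ℝ) := by exact_mod_cast hM
    push_cast at this; linarith
  unfold gorttwDeltaSq windowSeqDown
  rw [show k + 2 - 2 = k by omega, show k + 2 - 1 = k + 1 by omega, show (2 : ℕ) - 1 = 1 from rfl, pow_one,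
    xiTaylorCoeff_window_ratio k]
  push_cast
  -- `r := M_{2k}M_{2k+4}/M_{2k+2}² ≤ 20(k+2)/(20(k+2) − 9)`
  have hA := xiMoment_pos (2 * k)
  have hB := xiMoment_pos (2 * k + 2)
  have hC := xiMoment_pos (2 * k + 4)
  have hdef := xiMoment_turan_defect k hk
  have hden : 0 < 20 * ((k : ℝ) + 2) - 9 := by linarith
  have hr : xiMoment (2 * k) * xiMoment (2 * k + 4) / xiMoment (2 * k + 2) ^ 2 ≤
      20 * ((k : ℝ) + 2) / (20 * ((k : ℝ) + 2) - 9) := by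
    rw [div_le_div_iff₀ (pow_pos hB 2) hden]
    have e : xiMoment (2 * k) * xiMoment (2 * k + 4) * (1 - 9 / (20 * ((k : ℝ) + 2))) =
        xiMoment (2 * k) * xiMoment (2 * k + 4) * (20 * ((k : ℝ) + 2) - 9) / (20 * ((k : ℝ) + 2)) := by
      field_simp
    rw [e, div_le_iff₀ (by linarith)] at hdef
    linarith
  have hq0 : 0 ≤ (2 * (k : ℝ) + 1) / (2 * (k : ℝ) + 3) := by positivity
  have hstep : (2 * (k : ℝ) + 1) / (2 * (k : ℝ) + 3) * (xiMoment (2 * k) * xiMoment (2 * k + 4) / xiMoment (2 * k + 2) ^ 2) ≤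
      (2 * (k : ℝ) + 1) / (2 * (k : ℝ) + 3) * (20 * ((k : ℝ) + 2) / (20 * ((k : ℝ) + 2) - 9)) :=
    mul_le_mul_of_nonneg_left hr hq0
  have hk2 : (0 : ℝ) < (k : ℝ) + 2 := by positivity
  have h23 : (0 : ℝ) < 2 * (k : ℝ) + 3 := by positivity
  -- the comparison value: `q·R₀ ≤ 1 − 13/(25(k+2))`
  have hfrac : (2 * (k : ℝ) + 1) / (2 * (k : ℝ) + 3) * (20 * ((k : ℝ) + 2) / (20 * ((k : ℝ) + 2) - 9)) ≤
      1 - 13 / (25 * ((k : ℝ) + 2)) := by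
    have hk0 : (0 : ℝ) ≤ (k : ℝ) := Nat.cast_nonneg k
    have epoly : (2 * (k : ℝ) + 1) * (20 * ((k : ℝ) + 2)) * (25 * ((k : ℝ) + 2)) ≤
        (25 * ((k : ℝ) + 2) - 13) * ((2 * (k : ℝ) + 3) * (20 * ((k : ℝ) + 2) - 9)) := by
      have e : (25 * ((k : ℝ) + 2) - 13) * ((2 * (k : ℝ) + 3) * (20 * ((k : ℝ) + 2) - 9)) -
          (2 * (k : ℝ) + 1) * (20 * ((k : ℝ) + 2)) * (25 * ((k : ℝ) + 2)) = 30 * (k : ℝ) ^ 2 + 839 * k + 1441 := by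
        ring
      have h0 : (0 : ℝ) ≤ 30 * (k : ℝ) ^ 2 + 839 * k + 1441 := by positivity
      linarith
    have e1 : 1 - 13 / (25 * ((k : ℝ) + 2)) = (25 * ((k : ℝ) + 2) - 13) / (25 * ((k : ℝ) + 2)) := by
      field_simp
    rw [div_mul_div_comm, div_le_iff₀ (mul_pos h23 hden), e1, div_mul_eq_mul_div, le_div_iff₀ (by positivity)]
    exact epoly
  have eX : ∀ X : ℝ, 2 * ((k : ℝ) + 2) * ((1 - X) / 2) = ((k : ℝ) + 2) - ((k : ℝ) + 2) * X := fun X => by ring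
  rw [eX]
  have h1 := mul_le_mul_of_nonneg_left (hstep.trans hfrac) hk2.le
  have e2 : ((k : ℝ) + 2) * (1 - 13 / (25 * ((k : ℝ) + 2))) = ((k : ℝ) + 2) - 13 / 25 := by
    field_simp
  linarith [h1, e2]

/-- **Item closer** (route `JensenPolynomials`, support item `XiDeltaLower052`): `13/25 ≤ 2M·Δ(M)²` for all `M ≥ 10⁴`
(RH-FREE, zero-free; Brascamp–Lieb one-cell design of rh-jensen-eng-5 ET3 §5). -/
theorem xiDeltaLower052_item : Summit.RiemannHypothesis.RiemannHypothesis.Theses.JensenPolynomials.XiDeltaLower052 :=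
  fun M hM => two_mul_gorttwDeltaSq_ge M hM

end Summit.RiemannHypothesis.RiemannHypothesis.Theorems.JensenPolynomials

end
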